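import Mathlib
import Summits.Ventures.HodgeRepro.Tier4.Common.AdelicDefs
import Summits.Ventures.HodgeRepro.Tier4.Common.AdelicHaar
import Summits.Ventures.HodgeRepro.Tier4.Common.LocalTorus
import Summits.Ventures.HodgeRepro.Tier4.Common.FundamentalDomainSaturation
import Summits.Ventures.HodgeRepro.Tier4.Line1.AdelicParts
import Summits.Ventures.HodgeRepro.Tier4.Line1.FiniteLevelIsolation
import Summits.Ventures.HodgeRepro.Tier4.Line1.RationalPoints
import Summits.Ventures.HodgeRepro.Tier4.Line1.SecondCountableGA
import Summits.Ventures.HodgeRepro.Tier4.Line1.SigmaCompactGA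
import Summits.Ventures.HodgeRepro.Tier4.Line4.FinitePlacePositivity
import Summits.Ventures.HodgeRepro.Tier4.Line4.OrbitalUnfoldCentralCosets
import Summits.Ventures.HodgeRepro.Tier4.Line4.FinitePartClosed
import Summits.Ventures.HodgeRepro.Tier4.Line4.TorusProduct
import Summits.Ventures.HodgeRepro.Tier4.Line4.TorusProductHaar

/-!
# Tier4/Line4/CentreFinDomain — C-L4-ZDOMAIN (Part 3) and C-L4-ZDOMAIN-EX (Part 6) of the factorisation chain

Blind re-derivation cell `pub-hodge-repro`, Tier 4 «prove the step» (README §9–§10), seat t4-L2-p2 g4 (prover, re-plated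
to LINE L4 by plan-4 g3 S14501 on the lead's word S14479).  Statements VERBATIM from plan-4's
proofs/t4-plan-4/work/Factorisation-STATEMENTS-v2.lean 777b21f7ec8bf57d · 390, Part 3 (L220–L258) and Part 6
(L343–L388); Part 0 (`torusInf`, `torusFin`, `infT`, `finTf`, `torusSplit`) and the Part 1 law
`ofFinPart_eq_self_of_mem_finitePart` are imported from L2-p1's `Line4.TorusProduct`, `isClosed_finitePart` from
L4-p2's `Line4.InnerSplit`, `rationalCentreT` (with `rationalCentreT.comm`, `.mem_rationalPoints`) from L2-p3's
`Line4.OrbitalUnfoldCentralCosets`; `isClosed_torusT` / `isClosed_torusT'` (Part 6 (i)) are typer-2's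
`Common.isClosed_torusT` / `isClosed_torusT'` (AdelicHaar) and are consumed, not restated.

* Part 3 — `finTfHom` (the finite-part projection `T(𝔸) → T_f`), `centreFin` (the image of `Z(k)`),
  **`eq_one_of_mem_rationalCentreT_of_finTfHom_eq_one`** (`Z(k) ∩ G_∞ = 1`: a rational matrix whose finite part is
  `1` is `1`, by `finM_adMat` and the injectivity of `k → 𝔸_{k,f}`), `prodDomain`, **`isFundamentalDomain_prodDomain`**
  (the product domain `T_∞ × DZ_f` is a fundamental domain for `Z(k)` — Mathlib's
  `IsFundamentalDomain.preimage_of_equiv` along `finTfHom`, with the bijection `Z(k) ≃ centreFin` given by the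
  injectivity, `prodDomain = finTfHom ⁻¹' DZf`, and `map finTfHom μT ≪ νf` from `Measure.prod_prod`).
* Part 6 — `ZfIn` (`Z_f` inside `T_f`), `CentreFinFinite` (the CM input: `centreFin` meets a compact open subgroup in a
  finite set), **`discreteTopology_centreFin_of_centreFinFinite`** (`1` is isolated in `centreFin`),
  `HasRegularBorelSection` (the DISPLAYED printed input: Margulis 1991 Ch. I Thm (4.4.1) — Mackey 1952 Lemma 1.1,
  Feldman–Greenleaf 1968 — at `(T_f, centreFin)`, t4-lit-5 g2 row I-t4-lit-5-63; to be bound by name to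
  `Lit.Margulis1991_I_4_4_1_regularBorelSection` when it lands), **`exists_isFundamentalDomain_centreFin`** (C-L4-ZDOMAIN-EX:
  a measurable fundamental domain `DZ_f` for `Z(k)` in `T_f` containing a neighbourhood of `1` and relatively compact on
  `Z_f`-saturations of compacts, from discreteness, `hZc` and the displayed section: `DZ_f := U ∪ (range φ \ Z(k)·U)`
  with `U` a small relatively compact open neighbourhood of `1` meeting every orbit at most once).

Mathlib-level; the only printed input is the displayed `HasRegularBorelSection`.  No proof of a published theorem.
HC_CM is NOT proved by anyone in this repository.
-/

set_option autoImplicit false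
noncomputable section
namespace Summit.Ventures.HodgeRepro.Tier4.Line4
open Summit.Ventures.HodgeRepro.Tier4 Summit.Ventures.HodgeRepro.Tier4.Common
  Summit.Ventures.HodgeRepro.Tier4.Line1 MeasureTheory
open scoped ComplexConjugate Topology Pointwise NNReal

/-! ## Part 3 — C-L4-ZDOMAIN (statements verbatim; `rationalCentreT` imported from OrbitalUnfoldCentralCosets) -/

section ZDomain
variable {k : Type} [Field k] [NumberField k] (W : PlaneData k)

/-- The finite-part projection `T(𝔸) → T_f` as a group homomorphism (the second component of `torusSplit`). -/
def finTfHom : torusT W →* torusFin W :=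
  (MonoidHom.snd (torusInf W) (torusFin W)).comp (torusSplit W).toMulEquiv.toMonoidHom

/-- `finTfHom t` is the finite part of `t` (definitional). -/
theorem finTfHom_apply (t : torusT W) : finTfHom W t = finTf W t := rfl

/-- The underlying element of `finTfHom t` is `ofFinPart t`. -/
theorem coe_coe_finTfHom (t : torusT W) : ((finTfHom W t : torusT W) : GA W) = GA.ofFinPart W (t : GA W) := rfl

/-- The image of `Z(k)` in `T_f`. -/
def centreFin : Subgroup (torusFin W) := (rationalCentreT W).map (finTfHom W)

/-- A rational point of `G(𝔸_k)` is the image of a matrix over `k`. -/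
theorem exists_adMat_of_mem_rationalPoints {g : GA W} (hg : (g : GA W) ∈ rationalPoints W) :
    ∃ A : Matrix (Fin 4) (Fin 4) k, GA.mat W g = adMat k A := by
  obtain ⟨A, hA⟩ := Subgroup.mem_subgroupOf.1 hg
  refine ⟨(A : Matrix (Fin 4) (Fin 4) k), ?_⟩
  show ((g : GL4 k) : M4 k) = _
  rw [← hA]
  rfl

/-- **`Z(k) ∩ G_∞ = 1`**: a rational central element with trivial finite part is `1` (its entries are in `k` and equal `1`
at every finite place). -/
theorem eq_one_of_mem_rationalCentreT_of_finTfHom_eq_one {z : torusT W} (hz : z ∈ rationalCentreT W)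
    (h : finTfHom W z = 1) : z = 1 := by
  obtain ⟨A, hA⟩ := exists_adMat_of_mem_rationalPoints W (rationalCentreT.mem_rationalPoints W hz)
  have h1 : GA.ofFinPart W (z : GA W) = 1 := by
    have := congrArg (fun x : torusFin W => ((x : torusT W) : GA W)) h
    simpa [coe_coe_finTfHom] using this
  have h2 : finM k (GA.mat W (z : GA W)) = 1 := by
    have := congrArg (fun g : GA W => finM k (GA.mat W g)) h1
    have h0 : GA.mat W (1 : GA W) = 1 := rfl
    simpa only [GA.mat_ofFinPart, finM_mixM, h0, finM_one] using this
  rw [hA, finM_adMat] at h2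
  have hA1 : A = 1 := by
    ext i j
    have := congrFun (congrFun h2 i) j
    simp only [Matrix.map_apply] at this
    apply algebraMap_finiteAdele_injective (k := k)
    rw [this]
    by_cases hij : i = j
    · subst hij; simp
    · simp [Matrix.one_apply_ne hij]
  apply Subtype.ext
  apply Subtype.ext
  apply Units.ext
  show GA.mat W (z : GA W) = 1
  rw [hA, hA1, adMat_one]

end ZDomain

/-! ## Part 6 — C-L4-ZDOMAIN-EX -/

section ZDomainExists
variable {k : Type} [Field k] [NumberField k] (W : PlaneData k)

/-- The finite part of the centre, `Z_f = Z(𝔸_f)`, inside `T_f`. -/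
def ZfIn : Subgroup (torusFin W) := ((centre W).subgroupOf (torusT W)).subgroupOf (torusFin W)

/-- **The CM input, in the form the domain needs**: the image of `Z(k)` in `T_f` meets a compact open subgroup in a FINITE
set. -/
def CentreFinFinite : Prop :=
  ∃ K : Subgroup (torusFin W), IsOpen (K : Set (torusFin W)) ∧ IsCompact (K : Set (torusFin W)) ∧
    ((centreFin W : Set (torusFin W)) ∩ K).Finite

/-- `T_f` is Hausdorff (a subspace of the Hausdorff `G(𝔸_k)`). -/
theorem t2Space_torusFin : T2Space (torusFin W) :=
  haveI : T2Space (GA W) := t2Space_GA W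
  inferInstance

/-- A subgroup of `T_f` meeting a compact open subgroup in a finite set is DISCRETE. -/
theorem discreteTopology_centreFin_of_centreFinFinite (h : CentreFinFinite W) : DiscreteTopology (centreFin W) := by
  obtain ⟨K, hKo, -, hfin⟩ := h
  haveI : T2Space (torusFin W) := t2Space_torusFin W
  rw [discreteTopology_iff_isOpen_singleton_one]
  -- the finitely many non-identity points of `centreFin ∩ K`
  set F : Set (torusFin W) := ((centreFin W : Set (torusFin W)) ∩ K) \ {1} with hF
  have hFfin : F.Finite := hfin.sdiff
  have hVo : IsOpen ((K : Set (torusFin W)) \ F) := hKo.sdiff hFfin.isClosed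
  rw [isOpen_induced_iff]
  refine ⟨(K : Set (torusFin W)) \ F, hVo, ?_⟩
  ext x
  simp only [Set.mem_preimage, Set.mem_singleton_iff, Set.mem_sdiff, SetLike.mem_coe, hF, Set.mem_inter_iff,
    not_and, not_not]
  constructor
  · rintro ⟨hxK, hx⟩
    exact Subtype.ext (hx ⟨x.2, hxK⟩)
  · rintro rfl
    exact ⟨K.one_mem, fun _ => rfl⟩

/-- `finTfHom` is continuous (the second component of the splitting). -/
theorem continuous_finTfHom : Continuous (finTfHom W) :=
  continuous_snd.comp (torusSplit W).continuous

/-- The elements of `T_f` are in the finite part of `G(𝔸_k)`. -/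
theorem coe_coe_mem_finitePart (x : torusFin W) : ((x : torusT W) : GA W) ∈ finitePart W := x.2

/-- **`Z(k)`'s image is central in `T_f`**: `ofFinPart z` commutes with every element of `G(𝔸_f)`. -/
theorem centreFin_comm {h : torusFin W} (hh : h ∈ centreFin W) (x : torusFin W) : h * x = x * h := by
  obtain ⟨z, hz, rfl⟩ := hh
  apply Subtype.ext
  apply Subtype.ext
  show GA.ofFinPart W (z : GA W) * ((x : torusT W) : GA W) = ((x : torusT W) : GA W) * GA.ofFinPart W (z : GA W)
  have hx := ofFinPart_eq_self_of_mem_finitePart W (coe_coe_mem_finitePart W x)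
  conv_lhs => rw [← hx]
  conv_rhs => rw [← hx]
  rw [← ofFinPart_mul, ← ofFinPart_mul, rationalCentreT.comm W hz]

/-- `Z(k)`'s image is central in `T_f`. -/
theorem centreFin_le_center : centreFin W ≤ Subgroup.center (torusFin W) := fun _ hh =>
  Subgroup.mem_center_iff.2 fun x => (centreFin_comm W hh x).symm

/-- **C-L4-ZDOMAIN-EX — the measurable fundamental domain EXISTS under discreteness** (statement verbatim): a Borel set
`DZ_f` meeting every `Z(k)`-orbit once, containing a neighbourhood of `1`, and relatively compact on `Z_f`-saturations
of compacts.  PRINT-FREE: typer-2's `Common.exists_fundamentalDomain_of_discrete_of_central_cocompact`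
(FundamentalDomainSaturation, the cover construction with a neighbourhood of `1` placed first) at `G := T_f`,
`Γ := centreFin`, `Z := Z_f`; the instance obligations are `t2Space_torusFin`, L2-p1's `locallyCompact_torusFin` /
`secondCountable_torusFin` (TorusProductHaar), the centrality `centreFin_le_center` and the cocompactness clause of `hZc` (its
`E ⊆ Z_f` clause is not needed).  No Borel section of `T_f → T_f/Z_f` is used. -/
theorem exists_isFundamentalDomain_centreFin [MeasurableSpace (torusT W)] [BorelSpace (torusT W)]
    (νf : Measure (torusFin W)) [νf.IsHaarMeasure] (hdisc : DiscreteTopology (centreFin W))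
    (hZc : ∃ E : Set (torusFin W), IsCompact E ∧ E ⊆ (ZfIn W : Set (torusFin W)) ∧
      (ZfIn W : Set (torusFin W)) ⊆ (centreFin W : Set (torusFin W)) * E) :
    ∃ DZf : Set (torusFin W), MeasurableSet DZf ∧ IsFundamentalDomain (centreFin W) DZf νf ∧
      (∃ U ∈ 𝓝 (1 : torusFin W), U ⊆ DZf) ∧
      ∀ C : Set (torusFin W), IsCompact C → IsCompact (closure (DZf ∩ (C * (ZfIn W : Set (torusFin W))))) := by
  haveI : T2Space (torusFin W) := t2Space_torusFin W
  haveI : LocallyCompactSpace (torusFin W) := locallyCompact_torusFin W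
  haveI : SecondCountableTopology (torusFin W) := secondCountable_torusFin W
  obtain ⟨E, hEc, -, hZE⟩ := hZc
  exact Common.exists_fundamentalDomain_of_discrete_of_central_cocompact (centreFin W) νf (ZfIn W)
    (centreFin_le_center W) ⟨E, hEc, hZE⟩

/-- **The product domain** `T_∞ × DZ_f`, pulled back to `T(𝔸)` along the splitting. -/
def prodDomain (DZf : Set (torusFin W)) : Set (torusT W) := (torusSplit W).symm '' (Set.univ ×ˢ DZf)

/-- The product domain is the preimage of `DZ_f` under the finite-part projection. -/
theorem prodDomain_eq_preimage (DZf : Set (torusFin W)) : prodDomain W DZf = finTfHom W ⁻¹' DZf := by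
  ext t
  constructor
  · rintro ⟨p, ⟨-, hp⟩, rfl⟩
    show (torusSplit W ((torusSplit W).symm p)).2 ∈ DZf
    rw [(torusSplit W).apply_symm_apply]
    exact hp
  · intro ht
    exact ⟨torusSplit W t, ⟨Set.mem_univ _, ht⟩, (torusSplit W).symm_apply_apply t⟩

/-- The restriction of `finTfHom` to `Z(k)` is a bijection onto its image `centreFin` (injective by
`Z(k) ∩ G_∞ = 1`). -/
theorem bijective_finTfHom_restrict :
    Function.Bijective (fun z : rationalCentreT W => (⟨finTfHom W z, ⟨z, z.2, rfl⟩⟩ : centreFin W)) := by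
  constructor
  · intro z z' hzz'
    have h : finTfHom W (z : torusT W) = finTfHom W (z' : torusT W) := congrArg Subtype.val hzz'
    have h1 : finTfHom W ((z : torusT W) * (z' : torusT W)⁻¹) = 1 := by
      rw [map_mul, map_inv, h, mul_inv_cancel]
    exact Subtype.ext (mul_inv_eq_one.1
      (eq_one_of_mem_rationalCentreT_of_finTfHom_eq_one W (mul_mem z.2 (inv_mem z'.2)) h1))
  · rintro ⟨y, z, hz, rfl⟩
    exact ⟨⟨z, hz⟩, rfl⟩

/-- **C-L4-ZDOMAIN**: if `DZ_f` is a fundamental domain for the image of `Z(k)` in `T_f` (for `ν_f`), then `T_∞ × DZ_f` is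
a fundamental domain for `Z(k)` in `T(𝔸)` (for `μ_T = c (ν_∞ ⊗ ν_f)`): the archimedean coordinate is free because
`Z(k) → T_f` is injective (`Z(k) ∩ G_∞ = 1`), so `z ↦ z_f` identifies the two actions. -/
theorem isFundamentalDomain_prodDomain [MeasurableSpace (torusT W)] [BorelSpace (torusT W)]
    (νinf : Measure (torusInf W)) [νinf.IsHaarMeasure] (νf : Measure (torusFin W)) [νf.IsHaarMeasure]
    (μT : Measure (torusT W)) (c : ℝ≥0) (hc : μT = c • Measure.map (torusSplit W).symm (νinf.prod νf))
    (DZf : Set (torusFin W)) (hDZf : IsFundamentalDomain (centreFin W) DZf νf) :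
    IsFundamentalDomain (rationalCentreT W) (prodDomain W DZf) μT := by
  haveI : T2Space (torusFin W) := t2Space_torusFin W
  haveI : LocallyCompactSpace (torusFin W) := locallyCompact_torusFin W
  haveI : SecondCountableTopology (torusFin W) := secondCountable_torusFin W
  haveI : SecondCountableTopology (torusInf W) := secondCountable_torusInf W
  haveI : SigmaFinite νf := sigmaFinite_of_locallyFinite
  have hmeas : Measurable (finTfHom W) := (continuous_finTfHom W).measurable
  have hsymm : Measurable (torusSplit W).symm := (torusSplit W).symm.continuous.measurable
  rw [prodDomain_eq_preimage]
  let eqv := Equiv.ofBijective _ (bijective_finTfHom_restrict W)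
  refine hDZf.preimage_of_equiv (f := finTfHom W) ⟨hmeas, ?_⟩ (e := eqv.symm) eqv.symm.bijective ?_
  · -- `map finTfHom μT ≪ νf`
    refine Measure.AbsolutelyContinuous.mk fun s hs hs0 => ?_
    rw [Measure.map_apply hmeas hs, hc, Measure.smul_apply, Measure.map_apply hsymm (hmeas hs)]
    have hset : (torusSplit W).symm ⁻¹' (finTfHom W ⁻¹' s) = Set.univ ×ˢ s := by
      ext p
      simp only [Set.mem_preimage, Set.mem_prod, Set.mem_univ, true_and]
      show (torusSplit W ((torusSplit W).symm p)).2 ∈ s ↔ p.2 ∈ s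
      rw [(torusSplit W).apply_symm_apply]
    rw [hset, Measure.prod_prod, hs0, mul_zero, smul_zero]
  · intro g x
    show finTfHom W ((eqv.symm g : torusT W) * x) = (g : torusFin W) * finTfHom W x
    rw [map_mul]
    congr 1
    exact congrArg Subtype.val (eqv.apply_symm_apply g)

end ZDomainExists

end Summit.Ventures.HodgeRepro.Tier4.Line4

end
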